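import Literature.MathematicalPhysics.QuantumFieldTheory.Balaban1983to89.B13Lemma3WindowChain

/-!
# `Balaban1983to89.B13Lemma3WindowNonvacuity` — T. Bałaban, *Renormalization group approach to lattice gauge field
theories. II. Cluster expansions*, Commun. Math. Phys. **116** (1988) 1–22 [Balaban1988RG2Cluster]: NON-VACUITY of the
numerical restrictions on the constants under which the §2 chain on the two-scale window model was landed
(`B13Lemma3Window.bound238_window`, `B13Lemma3WindowTerms.bound238_window_of_226`,
`B13Lemma3WindowChain.deliverables_window_of_226`).

statement-level skeleton of published theorems with citation tags; proofs where landed; nothing here is a claim about the Yang–Mills mass gap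

p. 21, verbatim: *"The assumptions allow finally us to fix all the constants, or rather bounds on these constants."* The
three theorems above carry the printed restrictions of pp. 17–21 (R15–R18, R20, R22–R24, the smallness conditions of
(2.29)/(2.31), the choice of the absolute constants O(1) of (2.37)/(2.38)/(2.41)) as some forty explicit real-number
hypotheses on `c : B13.Consts` and on the auxiliary rates `a, a₂, a₂', a₅, Aabs, Bc` and the bond-cube size `M`. This
file exhibits ONE assignment of all of them (d = 4, L = 8, ℓ = L/2 = 4, δ = 3/40 so that (1 − 10δ)·½L = 1 exactly,
κ = 20(κ₀(64,8) + 64), κ₁ − 1 = 34(1 − 7δ)·4κ, α₆ = (e·K₀(64,8)·64)⁻¹, ε₂ := the explicit small number `ε₂w`, ε₁ read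
off from ε₂ = 2E₀ε₁C₁α₄⁻¹α₆⁻¹M^q e^{C₂κ₁}, a = 20(340κ + 1/ε₂)) at which every one of these hypotheses holds
(Part 3, one private lemma per hypothesis), so that the hypothesis lists of the three theorems are jointly satisfiable
with ε₁ > 0 (`numerics_nonvacuous`) and the chain specializes to a statement whose only remaining inputs are the
model's structural ones (`deliverables_window_consts`). The witness says nothing about the size of the physical
constants; it certifies only that the inequalities as typed are consistent (in particular that no sign or direction
was mistyped). (The typed theorems do not identify the bond-cube side `M : ℕ` of (2.30) with the field `c.M` of
restriction R24; the witness takes the former = 1 and the latter = κ + 1.)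
-/

namespace Literature.MathematicalPhysics.QuantumFieldTheory.Balaban1983to89.B13Lemma3WindowNonvacuity

open Literature.MathematicalPhysics.QuantumFieldTheory.Balaban1983to89
open Literature.MathematicalPhysics.QuantumFieldTheory.Balaban1983to89.B13ScaleTransfer (Pt collar closureIdx)
open Literature.MathematicalPhysics.QuantumFieldTheory.Balaban1983to89.TreeLengthCubeSystem (Dom sys cellsOf Touch)
open Literature.MathematicalPhysics.QuantumFieldTheory.Balaban1983to89.B12TreeDecay (kappa₀ K₀ K₀_pos kappa₀_nonneg)
open Literature.MathematicalPhysics.QuantumFieldTheory.Balaban1983to89.B13Lemma3Window (LBond TwoWindowStep)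
open Literature.MathematicalPhysics.QuantumFieldTheory.Balaban1983to89.B13Lemma3WindowTerms (terms weight)
open Literature.MathematicalPhysics.QuantumFieldTheory.Balaban1983to89.B13Resummation (locE)

noncomputable section

/-! ## Part 1. The witness -/

/-- The d = 4 window animal constant K₀(64, 8) = e^{64 log 162}/81. [folklore] -/
def Kw : ℝ := K₀ 64 8

/-- The d = 4 window tree-decay threshold κ₀(64, 8) = 64 log 162. [folklore] -/
def κ₀w : ℝ := kappa₀ 64 8

/-- κ := 20 (κ₀ + 64). [folklore] -/
def κw : ℝ := 20 * (κ₀w + 64)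

/-- δ := 3/40, so that (1 − 10δ)·½L = 1 at L = 8 (p. 21). [folklore] -/
def δw : ℝ := 3 / 40

/-- The exponent (1 − 7δ)·½L·κ at L = 8. [folklore] -/
def μw : ℝ := (1 - 7 * δw) * 4 * κw

/-- κ₁ := 1 + 34 (1 − 7δ)·½L·κ (restriction R20 with equality). [folklore] -/
def κ₁w : ℝ := 1 + 34 * μw

/-- α₆ := (e · K₀(64,8) · 64)⁻¹ (the smallness condition of (2.29) with a₂ = 1, with equality). [folklore] -/
def α₆w : ℝ := (Real.exp 1 * Kw * 64)⁻¹

/-- An upper bound for the O(1) of (2.37), A(a) = K₀ e^{64 e^{−a/20}} ≤ K₀ e^{64}. [folklore] -/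
def Aup : ℝ := Kw * Real.exp 64

/-- A₁ := Aup · e^{64} / α₆ (the O(1) of C₃, p. 20). [folklore] -/
def A₁w : ℝ := Aup * Real.exp 64 / α₆w

/-- A₂ := e · 9 · 64 · K₀² (the O(1) of (2.41), p. 21). [folklore] -/
def A₂w : ℝ := Real.exp 1 * 9 * 64 * Kw ^ 2

/-- The value given to ε₂: small against e^{5κ}, e^{5(1−7δ)ℓκ}, the O(1)'s and α₆ at once. [folklore] -/
def ε₂w : ℝ := α₆w * Real.exp (-(5 * κw + 5 * μw + 1)) / (2 * 10000 * Aup * A₁w * A₂w * Kw * 576)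

/-- ε₁ read off from ε₂ = 2E₀ε₁C₁α₄⁻¹α₆⁻¹M^q e^{C₂κ₁} = ε₂w at E₀ = 2, C₁ = α₄ = C₂ = 1, q = 0. [folklore] -/
def ε₁w : ℝ := ε₂w * α₆w * Real.exp (-κ₁w) / 4

/-- The witness constants. [folklore] -/
def consts : B13.Consts where
  L := 8
  q := 0
  M := κw + 1
  κ := κw
  κ₁ := κ₁w
  δ := δw
  δ₀ := 1
  E₀ := 2
  ε₁ := ε₁w
  C₁ := 1
  C₂ := 1
  C₃ := 1
  α₀ := 1
  α₁ := 1
  α₄ := 1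
  α₅ := 1
  α₆ := α₆w
  γ₂ := 1
  γ := 1
  A₁ := A₁w
  A₂ := A₂w

/-- The decay rate `a` of (2.30)/(2.32): a/20 = 340κ + 1/ε₂. [folklore] -/
def aw : ℝ := 20 * (340 * κw + 1 / ε₂w)

/-! ## Part 2. Elementary facts about the witness -/

/-- κ₀(64, 8) = 64 log 162 (`TreeLengthCubeSystem.kappa₀_four`); private plumbing. [folklore] -/
private theorem κ₀w_eq : κ₀w = 64 * Real.log 162 := by
  have h := TreeLengthCubeSystem.kappa₀_four
  norm_num at h
  exact h

/-- κ₀ ≥ 0; private plumbing. [folklore] -/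
private theorem κ₀w_nonneg : 0 ≤ κ₀w := kappa₀_nonneg (by norm_num) 8

/-- K₀ > 0; private plumbing. [folklore] -/
private theorem Kw_pos : 0 < Kw := K₀_pos 64 8

/-- K₀(64, 8) ≥ 1 (as e^{64 log 162} ≥ 81; cf. `B12StepFromB13.one_le_K₀_four`); private plumbing. [folklore] -/
private theorem one_le_Kw : 1 ≤ Kw := by
  have hκ : kappa₀ 64 8 = 64 * Real.log 162 := κ₀w_eq
  show 1 ≤ K₀ 64 8
  unfold K₀
  rw [hκ, le_div_iff₀ (by positivity)]
  have h81 : Real.log 81 ≤ 64 * Real.log 162 := by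
    have h1 : Real.log 81 ≤ Real.log 162 := Real.log_le_log (by norm_num) (by norm_num)
    have h2 : 0 ≤ Real.log 162 := Real.log_nonneg (by norm_num)
    linarith
  have h := Real.exp_le_exp.mpr h81
  rw [Real.exp_log (by norm_num : (0 : ℝ) < 81)] at h
  norm_num
  linarith

/-- κ ≥ 1280; private plumbing. [folklore] -/
private theorem κw_ge : 1280 ≤ κw := by
  unfold κw; linarith [κ₀w_nonneg]

/-- κ > 0; private plumbing. [folklore] -/
private theorem κw_pos : 0 < κw := by linarith [κw_ge]

/-- (1 − 7δ)·4·κ = (19/10)κ at δ = 3/40; private plumbing. [folklore] -/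
private theorem μw_eq : μw = (19 / 10) * κw := by
  unfold μw δw; ring

/-- μ ≥ 0; private plumbing. [folklore] -/
private theorem μw_nonneg : 0 ≤ μw := by
  rw [μw_eq]; linarith [κw_pos]

/-- α₆ > 0; private plumbing. [folklore] -/
private theorem α₆w_pos : 0 < α₆w := by
  unfold α₆w; have := Kw_pos; positivity

/-- α₆ ≤ 1; private plumbing. [folklore] -/
private theorem α₆w_le_one : α₆w ≤ 1 := by
  unfold α₆w
  rw [inv_le_one_iff₀]
  right
  have h1 : 1 ≤ Real.exp 1 := Real.one_le_exp (by norm_num)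
  nlinarith [one_le_Kw, h1]

/-- Aup ≥ 1; private plumbing. [folklore] -/
private theorem one_le_Aup : 1 ≤ Aup := by
  unfold Aup
  have h1 : 1 ≤ Real.exp 64 := Real.one_le_exp (by norm_num)
  nlinarith [one_le_Kw, h1]

/-- Aup > 0; private plumbing. [folklore] -/
private theorem Aup_pos : 0 < Aup := by linarith [one_le_Aup]

/-- A₁ ≥ 1; private plumbing. [folklore] -/
private theorem one_le_A₁w : 1 ≤ A₁w := by
  unfold A₁w
  rw [le_div_iff₀ α₆w_pos]
  have h1 : 1 ≤ Real.exp 64 := Real.one_le_exp (by norm_num)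
  nlinarith [one_le_Aup, h1, α₆w_le_one, α₆w_pos]

/-- A₁ > 0; private plumbing. [folklore] -/
private theorem A₁w_pos : 0 < A₁w := by linarith [one_le_A₁w]

/-- A₂ ≥ 1; private plumbing. [folklore] -/
private theorem one_le_A₂w : 1 ≤ A₂w := by
  unfold A₂w
  have h1 : 1 ≤ Real.exp 1 := Real.one_le_exp (by norm_num)
  have h2 : 1 ≤ Kw ^ 2 := by nlinarith [one_le_Kw]
  nlinarith [h1, h2]

/-- A₂ > 0; private plumbing. [folklore] -/
private theorem A₂w_pos : 0 < A₂w := by linarith [one_le_A₂w]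

/-- The denominator of `ε₂w`. [folklore] -/
private theorem den_pos : 0 < 2 * 10000 * Aup * A₁w * A₂w * Kw * 576 := by
  have := Aup_pos; have := A₁w_pos; have := A₂w_pos; have := Kw_pos
  positivity

/-- ε₂ > 0; private plumbing. [folklore] -/
private theorem ε₂w_pos : 0 < ε₂w := by
  unfold ε₂w
  have := α₆w_pos; have := den_pos
  positivity

/-- ε₂ ≥ 0; private plumbing. [folklore] -/
private theorem ε₂w_nonneg : 0 ≤ ε₂w := ε₂w_pos.le

/-- `ε₂w · e^{5κ + 5μ + 1} · (2·10⁴·Aup·A₁·A₂·Kw·576) = α₆`. [folklore] -/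
private theorem ε₂w_mul : ε₂w * Real.exp (5 * κw + 5 * μw + 1) * (2 * 10000 * Aup * A₁w * A₂w * Kw * 576) = α₆w := by
  unfold ε₂w
  have h1 := ne_of_gt Aup_pos; have h2 := ne_of_gt A₁w_pos; have h3 := ne_of_gt A₂w_pos; have h4 := ne_of_gt Kw_pos
  rw [Real.exp_neg]
  field_simp

/-- The basic smallness of `ε₂w`: `ε₂w · e^{5κ + 5μ + 1} · X ≤ α₆` for every factor `X ≤ 2·10⁴·Aup·A₁·A₂·Kw·576`. [folklore] -/
private theorem ε₂w_le {X : ℝ} (hX : X ≤ 2 * 10000 * Aup * A₁w * A₂w * Kw * 576) :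
    ε₂w * Real.exp (5 * κw + 5 * μw + 1) * X ≤ α₆w := by
  calc ε₂w * Real.exp (5 * κw + 5 * μw + 1) * X
      ≤ ε₂w * Real.exp (5 * κw + 5 * μw + 1) * (2 * 10000 * Aup * A₁w * A₂w * Kw * 576) := by
        apply mul_le_mul_of_nonneg_left hX
        exact mul_nonneg ε₂w_nonneg (Real.exp_pos _).le
    _ = α₆w := ε₂w_mul

/-- ε₂ ≤ 1; private plumbing. [folklore] -/
private theorem ε₂w_le_one : ε₂w ≤ 1 := by
  have h := ε₂w_le (X := 1) (by
    have := one_le_Aup; have := one_le_A₁w; have := one_le_A₂w; have := one_le_Kw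
    nlinarith [mul_le_mul this one_le_A₁w (by norm_num) (by linarith), Aup_pos, A₁w_pos, A₂w_pos, Kw_pos,
      mul_pos Aup_pos A₁w_pos, mul_pos (mul_pos Aup_pos A₁w_pos) A₂w_pos,
      mul_pos (mul_pos (mul_pos Aup_pos A₁w_pos) A₂w_pos) Kw_pos])
  have h1 : 1 ≤ Real.exp (5 * κw + 5 * μw + 1) := Real.one_le_exp (by nlinarith [κw_pos, μw_nonneg])
  nlinarith [ε₂w_pos, α₆w_le_one]

/-! ### The derived products at the witness -/

/-- L = 8 at the witness; private plumbing. [folklore] -/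
private theorem L_consts : consts.L = 8 := rfl

/-- ½L = 4 at the witness; private plumbing. [folklore] -/
private theorem half_L : ((consts.L : ℝ) / 2) = 4 := by
  rw [L_consts]; norm_num

/-- The p. 19 product ε₂ = 2E₀ε₁C₁α₄⁻¹α₆⁻¹M^q e^{C₂κ₁} evaluates to `ε₂w` at the witness; private plumbing. [folklore] -/
private theorem eps2_consts : consts.eps2 = ε₂w := by
  rw [B13.Consts.eps2_printed]
  show 2 * 2 * (ε₂w * α₆w * Real.exp (-κ₁w) / 4) * 1 * (1 : ℝ)⁻¹ * α₆w⁻¹ * (κw + 1) ^ 0 * Real.exp (1 * κ₁w) = ε₂w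
  have hα := ne_of_gt α₆w_pos
  rw [Real.exp_neg]
  field_simp
  ring

/-- C₃ε₁ = 2(L+2)⁴A₁ε₂ = 2·10⁴·A₁·ε₂ at the witness; private plumbing. [folklore] -/
private theorem C3ε_consts : consts.C3act * consts.ε₁ = 2 * 10000 * A₁w * ε₂w := by
  rw [B13.Consts.C3act_mul_eps1, eps2_consts, L_consts]
  show 2 * (((8 : ℕ) : ℝ) + 2) ^ 4 * A₁w * ε₂w = 2 * 10000 * A₁w * ε₂w
  norm_num

/-- The O(1) of (2.37) at the witness rate, `A(a) = K₀ e^{64 e^{−a/20}}`, is at most `Aup`. [folklore] -/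
private theorem A_le_Aup : K₀ 64 8 * Real.exp (Real.exp (-(aw / 20)) * 64) ≤ Aup := by
  unfold Aup
  apply mul_le_mul_of_nonneg_left _ (K₀_pos 64 8).le
  rw [Real.exp_le_exp]
  have h : Real.exp (-(aw / 20)) ≤ 1 := by
    rw [Real.exp_le_one_iff]
    have : 0 ≤ aw := by unfold aw; have := ε₂w_pos; have := κw_pos; positivity
    linarith
  linarith

/-- The O(1) of (2.37) at the witness rate is ≥ 0; private plumbing. [folklore] -/
private theorem A_nonneg : 0 ≤ K₀ 64 8 * Real.exp (Real.exp (-(aw / 20)) * 64) :=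
  mul_nonneg (K₀_pos 64 8).le (Real.exp_pos _).le

/-- The per-member constant (L+2)⁴·A·ε₂ = 10⁴·A·ε₂ at the witness; private plumbing. [folklore] -/
private theorem memberF_consts (A : ℝ) : B13Step237.memberF consts A = 10000 * A * ε₂w := by
  unfold B13Step237.memberF
  rw [eps2_consts, L_consts]
  norm_num

/-- a/20 = 340κ + 1/ε₂; private plumbing. [folklore] -/
private theorem aw_div : aw / 20 = 340 * κw + 1 / ε₂w := by
  unfold aw; ring

/-- a ≥ 0; private plumbing. [folklore] -/
private theorem aw_nonneg : 0 ≤ aw := by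
  unfold aw; have := ε₂w_pos; have := κw_pos; positivity

/-- `e^{−1/x} ≤ x` for `x > 0`. [folklore] -/
private theorem exp_neg_inv_le {x : ℝ} (hx : 0 < x) : Real.exp (-(1 / x)) ≤ x := by
  have h1 : 1 / x ≤ Real.exp (1 / x) := by linarith [Real.add_one_le_exp (1 / x)]
  rw [Real.exp_neg, inv_le_comm₀ (Real.exp_pos _) hx]
  calc x⁻¹ = 1 / x := (one_div x).symm
    _ ≤ Real.exp (1 / x) := h1

/-- e^{−a/20} ≤ ε₂ (restriction R17 at the witness); private plumbing. [folklore] -/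
private theorem exp_aw_le_ε₂w : Real.exp (-(aw / 20)) ≤ ε₂w := by
  rw [aw_div]
  calc Real.exp (-(340 * κw + 1 / ε₂w)) ≤ Real.exp (-(1 / ε₂w)) := by
        rw [Real.exp_le_exp]; linarith [κw_pos]
    _ ≤ ε₂w := exp_neg_inv_le ε₂w_pos

/-- e^{−a/20} ≤ 1; private plumbing. [folklore] -/
private theorem exp_aw_le_one : Real.exp (-(aw / 20)) ≤ 1 := by
  rw [Real.exp_le_one_iff]; linarith [aw_nonneg]

/-! ### Lower bounds for the denominator of `ε₂w` -/

/-- The denominator of ε₂ is ≥ 1; private plumbing. [folklore] -/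
private theorem den_ge_one : 1 ≤ 2 * 10000 * Aup * A₁w * A₂w * Kw * 576 := by
  have h1 : (1 : ℝ) ≤ 2 * 10000 := by norm_num
  have h2 := one_le_mul_of_one_le_of_one_le h1 one_le_Aup
  have h3 := one_le_mul_of_one_le_of_one_le h2 one_le_A₁w
  have h4 := one_le_mul_of_one_le_of_one_le h3 one_le_A₂w
  have h5 := one_le_mul_of_one_le_of_one_le h4 one_le_Kw
  exact one_le_mul_of_one_le_of_one_le h5 (by norm_num)

/-- The denominator of ε₂ dominates 2·10⁴·Aup; private plumbing. [folklore] -/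
private theorem den_ge_Aup : 2 * 10000 * Aup ≤ 2 * 10000 * Aup * A₁w * A₂w * Kw * 576 := by
  have h0 : 0 ≤ 2 * 10000 * Aup := by linarith [Aup_pos]
  calc 2 * 10000 * Aup ≤ 2 * 10000 * Aup * (A₁w * A₂w * Kw * 576) :=
        le_mul_of_one_le_right h0 (one_le_mul_of_one_le_of_one_le
          (one_le_mul_of_one_le_of_one_le (one_le_mul_of_one_le_of_one_le one_le_A₁w one_le_A₂w) one_le_Kw)
          (by norm_num))
    _ = _ := by ring

/-- The denominator of ε₂ dominates 2·10⁴·A₁·K₀·576; private plumbing. [folklore] -/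
private theorem den_ge_A₁K : 2 * 10000 * A₁w * Kw * 576 ≤ 2 * 10000 * Aup * A₁w * A₂w * Kw * 576 := by
  have h0 : 0 ≤ 2 * 10000 * A₁w * Kw * 576 := by have := A₁w_pos; have := Kw_pos; positivity
  calc 2 * 10000 * A₁w * Kw * 576 ≤ 2 * 10000 * A₁w * Kw * 576 * (Aup * A₂w) :=
        le_mul_of_one_le_right h0 (one_le_mul_of_one_le_of_one_le one_le_Aup one_le_A₂w)
    _ = _ := by ring

/-- The denominator of ε₂ dominates 2·10⁴·A₁·A₂; private plumbing. [folklore] -/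
private theorem den_ge_A₁A₂ : 2 * 10000 * A₁w * A₂w ≤ 2 * 10000 * Aup * A₁w * A₂w * Kw * 576 := by
  have h0 : 0 ≤ 2 * 10000 * A₁w * A₂w := by have := A₁w_pos; have := A₂w_pos; positivity
  calc 2 * 10000 * A₁w * A₂w ≤ 2 * 10000 * A₁w * A₂w * (Aup * Kw * 576) :=
        le_mul_of_one_le_right h0
          (one_le_mul_of_one_le_of_one_le (one_le_mul_of_one_le_of_one_le one_le_Aup one_le_Kw) (by norm_num))
    _ = _ := by ring

/-- The working form of the smallness of `ε₂w`: `ε₂w · e^{E} · X ≤ α₆` whenever `E ≤ 5κ + 5μ + 1` and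
`0 ≤ X ≤ 2·10⁴·Aup·A₁·A₂·Kw·576`. [folklore] -/
private theorem ε₂w_small {X E : ℝ} (hX₀ : 0 ≤ X) (hX : X ≤ 2 * 10000 * Aup * A₁w * A₂w * Kw * 576)
    (hE : E ≤ 5 * κw + 5 * μw + 1) : ε₂w * Real.exp E * X ≤ α₆w := by
  calc ε₂w * Real.exp E * X ≤ ε₂w * Real.exp (5 * κw + 5 * μw + 1) * X := by
        apply mul_le_mul_of_nonneg_right _ hX₀
        exact mul_le_mul_of_nonneg_left (Real.exp_le_exp.mpr hE) ε₂w_nonneg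
    _ ≤ α₆w := ε₂w_le hX

/-- … and without the exponential: `ε₂w · X ≤ α₆ ≤ 1`. [folklore] -/
private theorem ε₂w_small' {X : ℝ} (hX₀ : 0 ≤ X) (hX : X ≤ 2 * 10000 * Aup * A₁w * A₂w * Kw * 576) :
    ε₂w * X ≤ 1 := by
  have h := ε₂w_small hX₀ hX (le_refl _)
  have h1 : 1 ≤ Real.exp (5 * κw + 5 * μw + 1) := Real.one_le_exp (by nlinarith [κw_pos, μw_nonneg])
  have h2 : ε₂w * X ≤ ε₂w * Real.exp (5 * κw + 5 * μw + 1) * X := by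
    have : ε₂w * X * 1 ≤ ε₂w * X * Real.exp (5 * κw + 5 * μw + 1) :=
      mul_le_mul_of_nonneg_left h1 (mul_nonneg ε₂w_nonneg hX₀)
    linarith
  linarith [α₆w_le_one]

/-! ## Part 3. The restrictions, one by one, at the witness -/

/-- L ≥ 8 at the witness; private plumbing. [folklore] -/
private theorem c_L : 8 ≤ consts.L := L_consts.ge

/-- α₆ > 0 at the witness; private plumbing. [folklore] -/
private theorem c_α₆ : 0 < consts.α₆ := α₆w_pos

/-- ε₂ ≥ 0 at the witness; private plumbing. [folklore] -/
private theorem c_eps2 : 0 ≤ consts.eps2 := by rw [eps2_consts]; exact ε₂w_nonneg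

/-- δ ≥ 0 at the witness; private plumbing. [folklore] -/
private theorem c_δ : 0 ≤ consts.δ := by show (0 : ℝ) ≤ 3 / 40; norm_num

/-- 1 − 7δ ≥ 0 at the witness; private plumbing. [folklore] -/
private theorem c_δ7 : 0 ≤ 1 - 7 * consts.δ := by show (0 : ℝ) ≤ 1 - 7 * (3 / 40); norm_num

/-- κ ≥ 0 at the witness; private plumbing. [folklore] -/
private theorem c_κ : 0 ≤ consts.κ := κw_pos.le

/-- R15 (ε₂ e^{5κ} ≤ 1, p. 18) at the witness; private plumbing. [folklore] -/
private theorem c_R15 : consts.R15 := by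
  unfold B13.Consts.R15
  rw [eps2_consts]
  show ε₂w * Real.exp (5 * κw) ≤ 1
  have h := ε₂w_small (X := 1) (E := 5 * κw) (by norm_num) den_ge_one (by linarith [μw_nonneg])
  linarith [α₆w_le_one]

/-- R16 in the form 17(1 − 4δ)κ ≤ a/20 (p. 18) at the witness; private plumbing. [folklore] -/
private theorem c_R16 : 17 * ((1 - 4 * consts.δ) * consts.κ) ≤ aw / 20 := by
  rw [aw_div]
  show 17 * ((1 - 4 * (3 / 40 : ℝ)) * κw) ≤ 340 * κw + 1 / ε₂w
  have h1 : 0 ≤ 1 / ε₂w := (one_div_pos.mpr ε₂w_pos).le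
  nlinarith [κw_pos]

/-- 4κ ≤ a/20 (p. 18) at the witness; private plumbing. [folklore] -/
private theorem c_R16' : 4 * consts.κ ≤ aw / 20 := by
  rw [aw_div]
  show 4 * κw ≤ 340 * κw + 1 / ε₂w
  have h1 : 0 ≤ 1 / ε₂w := (one_div_pos.mpr ε₂w_pos).le
  linarith [κw_pos]

/-- R17 (e^{−a/20} ≤ ε₂, p. 19) at the witness; private plumbing. [folklore] -/
private theorem c_R17 : Real.exp (-(aw / 20)) ≤ consts.eps2 := by
  rw [eps2_consts]; exact exp_aw_le_ε₂w

/-- The smallness condition of (2.31) at bond-cube side 1 at the witness; private plumbing. [folklore] -/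
private theorem c_231 : 2 * (4 : ℝ) * (((1 : ℕ) : ℝ)) ^ 4 * Real.exp (-(aw / 10)) ≤ aw / 20 := by
  have h1 : Real.exp (-(aw / 10)) ≤ 1 := by rw [Real.exp_le_one_iff]; linarith [aw_nonneg]
  have h2 : 8 ≤ aw / 20 := by
    rw [aw_div]
    have : 0 ≤ 1 / ε₂w := (one_div_pos.mpr ε₂w_pos).le
    linarith [κw_ge]
  norm_num
  linarith

/-- The rate condition of (2.29) (κ₀ + a₂ ≤ δκ, a₂ = 1) at the witness; private plumbing. [folklore] -/
private theorem c_κ229 : kappa₀ 64 8 + 1 ≤ consts.δ * consts.κ := by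
  show κ₀w + 1 ≤ 3 / 40 * (20 * (κ₀w + 64))
  linarith [κ₀w_nonneg]

/-- The smallness condition of (2.29) (α₆ e^{a₂} K₀ 64 ≤ a₂, a₂ = 1; equality) at the witness; private plumbing. [folklore] -/
private theorem c_sm229 : consts.α₆ * Real.exp 1 * K₀ 64 8 * 64 ≤ 1 := by
  show (Real.exp 1 * Kw * 64)⁻¹ * Real.exp 1 * Kw * 64 ≤ 1
  have h1 := ne_of_gt Kw_pos
  have h2 := (Real.exp_pos 1).ne'
  have h : (Real.exp 1 * Kw * 64)⁻¹ * Real.exp 1 * Kw * 64 = 1 := by field_simp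
  exact h.le

/-- The absorption 64 e^{−a/20} ≤ δκ at the witness; private plumbing. [folklore] -/
private theorem c_absk : Real.exp (-(aw / 20)) * 64 ≤ consts.δ * consts.κ := by
  show Real.exp (-(aw / 20)) * 64 ≤ 3 / 40 * (20 * (κ₀w + 64))
  linarith [exp_aw_le_one, κ₀w_nonneg]

/-- R18 ((L+2)⁴O(1)ε₂ ≤ ½, p. 20) at the witness; private plumbing. [folklore] -/
private theorem c_18half : B13Step237.R18half consts (K₀ 64 8 * Real.exp (Real.exp (-(aw / 20)) * 64)) := by
  unfold B13Step237.R18half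
  rw [memberF_consts]
  have h := ε₂w_small' (X := 2 * 10000 * Aup) (by linarith [Aup_pos]) den_ge_Aup
  have h1 : 10000 * (K₀ 64 8 * Real.exp (Real.exp (-(aw / 20)) * 64)) * ε₂w ≤ 10000 * Aup * ε₂w :=
    mul_le_mul_of_nonneg_right (mul_le_mul_of_nonneg_left A_le_Aup (by norm_num)) ε₂w_nonneg
  linarith

/-- R18 in the sharp form 2(L+2)⁴O(1)ε₂ e^{5(1−7δ)ℓκ} ≤ α₆ (p. 20) at the witness; private plumbing. [folklore] -/
private theorem c_18sharp :
    B13Step237.R18sharp consts (K₀ 64 8 * Real.exp (Real.exp (-(aw / 20)) * 64)) ((consts.L : ℝ) / 2) := by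
  unfold B13Step237.R18sharp B13Step237.bracketF
  rw [memberF_consts, half_L]
  show 2 * (10000 * (K₀ 64 8 * Real.exp (Real.exp (-(aw / 20)) * 64)) * ε₂w) *
      Real.exp (5 * ((1 - 7 * δw) * 4 * κw)) ≤ α₆w
  have h := ε₂w_small (X := 2 * 10000 * Aup) (E := 5 * μw) (by linarith [Aup_pos]) den_ge_Aup
    (by linarith [κw_pos])
  have hμ : (1 - 7 * δw) * 4 * κw = μw := rfl
  rw [hμ]
  have h1 : 2 * (10000 * (K₀ 64 8 * Real.exp (Real.exp (-(aw / 20)) * 64)) * ε₂w) * Real.exp (5 * μw) ≤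
      2 * (10000 * Aup * ε₂w) * Real.exp (5 * μw) := by
    apply mul_le_mul_of_nonneg_right _ (Real.exp_pos _).le
    apply mul_le_mul_of_nonneg_left _ (by norm_num)
    exact mul_le_mul_of_nonneg_right (mul_le_mul_of_nonneg_left A_le_Aup (by norm_num)) ε₂w_nonneg
  calc _ ≤ 2 * (10000 * Aup * ε₂w) * Real.exp (5 * μw) := h1
    _ = ε₂w * Real.exp (5 * μw) * (2 * 10000 * Aup) := by ring
    _ ≤ α₆w := h

/-- The rate condition of (2.29) at the k+1 scale (κ₀ + a₂′ ≤ δℓκ, a₂′ = 1) at the witness; private plumbing. [folklore] -/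
private theorem c_κ229' : kappa₀ 64 8 + 1 ≤ consts.δ * ((consts.L : ℝ) / 2) * consts.κ := by
  rw [half_L]
  show κ₀w + 1 ≤ 3 / 40 * 4 * (20 * (κ₀w + 64))
  linarith [κ₀w_nonneg]

/-- R20 (17(1 − 7δ)ℓκ ≤ (κ₁ − 1)/2, p. 20; equality) at the witness; private plumbing. [folklore] -/
private theorem c_R20 : 17 * ((1 - 7 * consts.δ) * ((consts.L : ℝ) / 2) * consts.κ) ≤ (consts.κ₁ - 1) / 2 := by
  rw [half_L]
  show 17 * ((1 - 7 * δw) * 4 * κw) ≤ (1 + 34 * ((1 - 7 * δw) * 4 * κw) - 1) / 2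
  linarith

/-- a₅ + e^{−(κ₁−1)/2} ≤ Aabs (a₅ = 0, Aabs = 1) at the witness; private plumbing. [folklore] -/
private theorem c_abs : 0 + Real.exp (-((consts.κ₁ - 1) / 2)) ≤ 1 := by
  show 0 + Real.exp (-((1 + 34 * μw - 1) / 2)) ≤ 1
  have h : Real.exp (-((1 + 34 * μw - 1) / 2)) ≤ 1 := by
    rw [Real.exp_le_one_iff]; linarith [μw_nonneg]
  linarith

/-- 64·Aabs ≤ δℓκ (Aabs = 1) at the witness; private plumbing. [folklore] -/
private theorem c_Ac : 1 * 64 ≤ consts.δ * ((consts.L : ℝ) / 2) * consts.κ := by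
  rw [half_L]
  show 1 * 64 ≤ 3 / 40 * 4 * (20 * (κ₀w + 64))
  linarith [κ₀w_nonneg]

/-- The choice of the O(1) of C₃ (p. 20): bracket/α₆ · e^{64 Aabs} ≤ C₃ε₁ at the witness; private plumbing. [folklore] -/
private theorem c_C3 : B13Step237.bracketF consts (K₀ 64 8 * Real.exp (Real.exp (-(aw / 20)) * 64)) / consts.α₆ *
    Real.exp (1 * 64) ≤ consts.C3act * consts.ε₁ := by
  rw [C3ε_consts]
  unfold B13Step237.bracketF
  rw [memberF_consts]
  show 2 * (10000 * (K₀ 64 8 * Real.exp (Real.exp (-(aw / 20)) * 64)) * ε₂w) / α₆w * Real.exp (1 * 64) ≤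
    2 * 10000 * (Aup * Real.exp 64 / α₆w) * ε₂w
  rw [one_mul]
  have hc : 0 ≤ 2 * 10000 * ε₂w * Real.exp 64 / α₆w := by
    have := ε₂w_pos; have := α₆w_pos; positivity
  calc 2 * (10000 * (K₀ 64 8 * Real.exp (Real.exp (-(aw / 20)) * 64)) * ε₂w) / α₆w * Real.exp 64
      = 2 * 10000 * ε₂w * Real.exp 64 / α₆w * (K₀ 64 8 * Real.exp (Real.exp (-(aw / 20)) * 64)) := by ring
    _ ≤ 2 * 10000 * ε₂w * Real.exp 64 / α₆w * Aup := mul_le_mul_of_nonneg_left A_le_Aup hc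
    _ = 2 * 10000 * (Aup * Real.exp 64 / α₆w) * ε₂w := by ring

/-- C₃ε₁ ≥ 0 at the witness; private plumbing. [folklore] -/
private theorem c_C3pos : 0 ≤ consts.C3act * consts.ε₁ := by
  rw [C3ε_consts]; have := A₁w_pos; have := ε₂w_pos; positivity

/-- The largeness of κ used in (2.41) ⇒ (I.1.18) (`B13Closing`) at the witness; private plumbing. [folklore] -/
private theorem c_large :
    consts.κ + 2 * (64 * Real.log 162) + 2 ≤ (1 - 8 * consts.δ) * ((consts.L : ℝ) / 2) * consts.κ := by
  rw [half_L, ← κ₀w_eq]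
  show 20 * (κ₀w + 64) + 2 * κ₀w + 2 ≤ (1 - 8 * (3 / 40)) * 4 * (20 * (κ₀w + 64))
  linarith [κ₀w_nonneg]

/-- The smallness of C₃ε₁ used in (2.39)–(2.41) (`B13Closing`) at the witness; private plumbing. [folklore] -/
private theorem c_small : consts.C3act * consts.ε₁ * Real.exp (5 * consts.κ + 1) * K₀ 64 8 * 9 * 64 ≤ 1 := by
  rw [C3ε_consts]
  show 2 * 10000 * A₁w * ε₂w * Real.exp (5 * κw + 1) * Kw * 9 * 64 ≤ 1
  have h := ε₂w_small (X := 2 * 10000 * A₁w * Kw * 576) (E := 5 * κw + 1)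
    (by have := A₁w_pos; have := Kw_pos; positivity) den_ge_A₁K (by linarith [μw_nonneg])
  calc 2 * 10000 * A₁w * ε₂w * Real.exp (5 * κw + 1) * Kw * 9 * 64
      = ε₂w * Real.exp (5 * κw + 1) * (2 * 10000 * A₁w * Kw * 576) := by ring
    _ ≤ α₆w := h
    _ ≤ 1 := α₆w_le_one

/-- The O(1) of (2.41), A₂ ≥ e·9·64·K₀² (equality) at the witness; private plumbing. [folklore] -/
private theorem c_A₂ : Real.exp 1 * 9 * 64 * K₀ 64 8 ^ 2 ≤ consts.A₂ := le_refl _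

/-- R22 ((1 − 10δ)·½L = 1, p. 21) at the witness; private plumbing. [folklore] -/
private theorem c_R22 : consts.R22 := by
  unfold B13.Consts.R22
  rw [half_L]
  show (1 - 10 * (3 / 40 : ℝ)) * 4 = 1
  norm_num

/-- R23 (O(1)C₃ε₁ ≤ ½E₀, p. 21) at the witness; private plumbing. [folklore] -/
private theorem c_R23 : consts.R23 := by
  unfold B13.Consts.R23
  rw [mul_assoc, C3ε_consts]
  show A₂w * (2 * 10000 * A₁w * ε₂w) ≤ 2 / 2
  have h := ε₂w_small' (X := 2 * 10000 * A₁w * A₂w) (by have := A₁w_pos; have := A₂w_pos; positivity)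
    den_ge_A₁A₂
  calc A₂w * (2 * 10000 * A₁w * ε₂w) = ε₂w * (2 * 10000 * A₁w * A₂w) := by ring
    _ ≤ 1 := h
    _ = 2 / 2 := by norm_num

/-- R24 (κ + 1 ≤ δ₀M, p. 21) at the witness; private plumbing. [folklore] -/
private theorem c_R24 : consts.R24sharp := by
  unfold B13.Consts.R24sharp
  show κw + 1 ≤ 1 * (κw + 1)
  linarith

/-- E₀ ≥ 0 at the witness; private plumbing. [folklore] -/
private theorem c_E₀ : 0 ≤ consts.E₀ := by show (0 : ℝ) ≤ 2; norm_num

/-- 64·Bc ≤ ½E₀ (Bc = 1/64) at the witness; private plumbing. [folklore] -/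
private theorem c_E₀def : 1 / 64 * 64 ≤ consts.E₀ / 2 := by show (1 : ℝ) / 64 * 64 ≤ 2 / 2; norm_num

/-- ε₁ > 0 at the witness (non-degeneracy); private plumbing. [folklore] -/
private theorem c_ε₁ : 0 < consts.ε₁ := by
  show 0 < ε₂w * α₆w * Real.exp (-κ₁w) / 4
  have := ε₂w_pos; have := α₆w_pos
  positivity

/-! ## Part 4. Non-vacuity -/

/-- **NON-VACUITY OF THE NUMERICAL RESTRICTIONS.** p. 21, verbatim: *"The assumptions allow finally us to fix all the
constants, or rather bounds on these constants."* — the explicit real-number hypotheses on the constants carried by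
`B13Lemma3Window.bound238_window` / `B13Lemma3WindowTerms.bound238_window_of_226` (restrictions R15–R18, R20, the
smallness conditions of (2.29) and (2.31), the choice of the O(1) of (2.37)/(2.38)) together with those of
`B13Lemma3WindowChain.deliverables_window_of_226` (the closing numerics of pp. 20–22: R22, R23, R24, the O(1) of (2.41),
the ½E₀ bookkeeping) are JOINTLY SATISFIABLE, with `ε₁ > 0`: witnessed by `consts`, bond-cube side `M = 1`, rate
`a = aw`, `a₂ = a₂' = 1`, `a₅ = 0`, `Aabs = 1`, `Bc = 1/64`. [cite: Balaban1988RG2Cluster, p.21 (closing paragraph: "The assumptions allow finally us to fix all the constants")] -/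
theorem numerics_nonvacuous :
    ∃ (c : B13.Consts) (M : ℕ) (a a₂ a₂' a₅ Aabs Bc : ℝ),
      8 ≤ c.L ∧ 0 < M ∧ 0 < c.ε₁ ∧ 0 < c.α₆ ∧ 0 ≤ c.eps2 ∧ 0 ≤ c.δ ∧ 0 ≤ 1 - 7 * c.δ ∧ 0 ≤ c.κ ∧ 0 ≤ a ∧
      c.R15 ∧ 17 * ((1 - 4 * c.δ) * c.κ) ≤ a / 20 ∧ 4 * c.κ ≤ a / 20 ∧ Real.exp (-(a / 20)) ≤ c.eps2 ∧
      2 * (4 : ℝ) * (M : ℝ) ^ 4 * Real.exp (-(a / 10)) ≤ a / 20 ∧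
      0 ≤ a₂ ∧ kappa₀ 64 8 + a₂ ≤ c.δ * c.κ ∧ c.α₆ * Real.exp a₂ * K₀ 64 8 * 64 ≤ a₂ ∧
      Real.exp (-(a / 20)) * 64 ≤ c.δ * c.κ ∧
      B13Step237.R18half c (K₀ 64 8 * Real.exp (Real.exp (-(a / 20)) * 64)) ∧
      B13Step237.R18sharp c (K₀ 64 8 * Real.exp (Real.exp (-(a / 20)) * 64)) ((c.L : ℝ) / 2) ∧
      0 ≤ a₂' ∧ kappa₀ 64 8 + a₂' ≤ c.δ * ((c.L : ℝ) / 2) * c.κ ∧ c.α₆ * Real.exp a₂' * K₀ 64 8 * 64 ≤ a₂' ∧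
      17 * ((1 - 7 * c.δ) * ((c.L : ℝ) / 2) * c.κ) ≤ (c.κ₁ - 1) / 2 ∧
      0 ≤ a₅ ∧ a₅ + Real.exp (-((c.κ₁ - 1) / 2)) ≤ Aabs ∧ Aabs * 64 ≤ c.δ * ((c.L : ℝ) / 2) * c.κ ∧
      B13Step237.bracketF c (K₀ 64 8 * Real.exp (Real.exp (-(a / 20)) * 64)) / c.α₆ * Real.exp (Aabs * 64) ≤
        c.C3act * c.ε₁ ∧
      0 ≤ c.C3act * c.ε₁ ∧ c.κ + 2 * (64 * Real.log 162) + 2 ≤ (1 - 8 * c.δ) * ((c.L : ℝ) / 2) * c.κ ∧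
      c.C3act * c.ε₁ * Real.exp (5 * c.κ + 1) * K₀ 64 8 * 9 * 64 ≤ 1 ∧
      Real.exp 1 * 9 * 64 * K₀ 64 8 ^ 2 ≤ c.A₂ ∧ c.R22 ∧ c.R23 ∧ c.R24sharp ∧ 0 ≤ c.E₀ ∧
      0 ≤ Bc ∧ Bc * 64 ≤ c.E₀ / 2 :=
  ⟨consts, 1, aw, 1, 1, 0, 1, 1 / 64, c_L, Nat.one_pos, c_ε₁, c_α₆, c_eps2, c_δ, c_δ7, c_κ, aw_nonneg, c_R15, c_R16,
    c_R16', c_R17, c_231, zero_le_one, c_κ229, c_sm229, c_absk, c_18half, c_18sharp, zero_le_one, c_κ229', c_sm229,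
    c_R20, le_refl _, c_abs, c_Ac, c_C3, c_C3pos, c_large, c_small, c_A₂, c_R22, c_R23, c_R24, c_E₀, by norm_num,
    c_E₀def⟩

open Classical in
/-- **THE §2 CHAIN AT THE WITNESS CONSTANTS.** `B13Lemma3WindowChain.deliverables_window_of_226` specialized to
`c = consts`, bond-cube side 1, rate `a = aw`, `a₅ = 0`, `Bc = 1/64`: every numerical hypothesis is discharged by the
witness, and what remains are the model's structural inputs only — (2.26) per term (`hH`, `h226`), the small-field
monotonicity `hsp`, (2.13) `h213`, the restriction record `W.Restr`, the log Z^{(k)} leaf `hlog`, (I.1.7) `W.Repr17`,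
analyticity and gauge invariance — delivering the clauses of Theorem I.3 (p. 21). [cite: Balaban1988RG2Cluster, pp.17–22 (Lemma 3 to Theorem I.3)] -/
theorem deliverables_window_consts {Bk Bk1 : Finset (Pt 4)} (hB : closureIdx consts.L (collar Bk) ⊆ Bk1)
    (W : TwoWindowStep Bk Bk1) (Tm : (Z : Dom Bk1) → Finset (Dom Bk) × Finset (LBond 4) → W.Φ → ℂ)
    (hH : ∀ (Z : Dom Bk1) (φ : W.Φ), φ ∈ W.sp2 Z → ‖W.H Z φ‖ ≤ ∑ t ∈ terms consts.L 1 Bk Z, ‖Tm Z t φ‖)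
    (h226 : ∀ (Z : Dom Bk1) (φ : W.Φ), φ ∈ W.sp2 Z → ∀ t ∈ terms consts.L 1 Bk Z,
      ‖Tm Z t φ‖ ≤ weight consts consts.L 1 Z aw t)
    (hsp : ∀ X Z : (sys Bk1).Dom, ∀ φ, Z.1 ⊆ X.1 → φ ∈ W.sp2 X → φ ∈ W.sp2 Z)
    (h213 : ∀ X : (sys Bk1).Dom, ∀ φ, φ ∈ W.sp2 X →
      W.Ek1 X φ = locE (Touch Bk1) (fun Z : (sys Bk1).Dom => cellsOf Bk1 Z.1) (fun Z => W.H Z φ) (cellsOf Bk1 X.1))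
    (hR : W.Restr)
    (hlog : B13.LogHalfBound W.toStepData.Dk1 W.toStepData.sp2 W.toStepData.Elog (fun X => X.1.card) (1 / 64)
      (consts.δ₀ * consts.M))
    (hrepr : W.Repr17) (han : ∀ X, W.Analytic (W.toStepData.Etot X) (W.sp2 X))
    (hg : ∀ X, W.GaugeInv (W.toStepData.Etot X)) :
    B13.Deliverables W.toStepData consts :=
  B13Lemma3WindowChain.deliverables_window_of_226 consts c_L hB W Nat.one_pos Tm (a₂ := 1) (a₂' := 1) (a₅ := 0)
    (Aabs := 1) hH
    (fun Z φ hφ t ht => by rw [zero_mul, Real.exp_zero, mul_one]; exact h226 Z φ hφ t ht)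
    c_α₆ c_eps2 c_δ c_δ7 c_κ aw_nonneg c_R15 c_R16 c_R16' c_R17 c_231 zero_le_one c_κ229 c_sm229 c_absk c_18half
    c_18sharp zero_le_one c_κ229' c_sm229 c_R20 (le_refl _) c_abs c_Ac c_C3 hsp h213 c_C3pos c_large c_small c_A₂ hR
    c_R22 c_R23 c_R24 c_E₀ (by norm_num) hlog c_E₀def hrepr han hg

end

end Literature.MathematicalPhysics.QuantumFieldTheory.Balaban1983to89.B13Lemma3WindowNonvacuity
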